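import Summits.NavierStokesRegularity.NavierStokesRegularity.Theorems.TypeILiouvilleGlobalFading
import Literature.Analysis.FluidPDE.SteadyNSBoundedMild
import HarnessLib

/-!
# TypeILiouvilleSteadySieve — decomp-ns ROOT CELL, lens 2 «structural dichotomy (special vs generic)», generation 24

Writer port (decomp-ns-writer-1 g9) of `decomp-ns-lens-2/TypeILiouvilleSteadySieve.lean` (sha256 10fa91de…7be1, 399 l;
CRITIC-LEDGER row 276 CLEARED (KERNEL), «landing --supports 10661 no objection»): VERBATIM except that the lens's final
summit-headed packaging `closes_root_sieved` is dropped (see §5). Helper for stmt-NavierStokesRegularity-10661; closes no item;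
Navier–Stokes regularity is NOT proved by anything here.

NODE g24 «THE STEADY SIEVE» — a KERNEL CERTIFICATE on the node of record (g18/g20/g21: the KNSS crux
(L) = stmt-NavierStokesRegularity-10661 `Theses.TypeILiouville.TypeIliouvilleL` is EXACTLY
`EL ∧ BCL ∧ LSL`, `Theorems.TypeILiouvilleGlobalFading.liouvilleL_iff_three_doors`; residual of record
L_Q = registered `stub_quiescentLiouville` ⟺ `BCL ∧ LSL`, `quiescentLiouville_iff_cells`). No new residual,
no new door: the certificate answers the critic's standing test on L_Q (CRITIC-LEDGER rows 188/230:
«converse UNDECIDED (test: steady Liouville from L_Q)»).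

SPECIAL STRATUM = UNIFORMLY RECURRENT PASTS (`∀ t < 0, ∀ ε > 0, ∀ T < 0, ∃ s < T, sup_x ‖v s x − v t x‖ ≤ ε`;
contains every STEADY and every time-PERIODIC bounded ancient flow). KERNEL RESULTS (0 sorry, no `def`):

* §1 `slice_const_of_quiescent_recurrent` — quiescent + recurrent ⟹ every slice constant (metric chaining
  through the landed `norm_sub_le_mul_dist_add_one`; no PDE); `eq_const_of_backwardConvergent_recurrent`.
* §2 THE FADING DOORS ARE BLIND TO THE RECURRENT STRATUM: `quiescentLiouville_onRecurrent` (L_Q; only the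
  landed momentum anchor `backwardConvergent_of_globallyFading` is used), `bcl_onRecurrent` (no PDE),
  `lsl_onRecurrent`, and the literal instances `quiescentLiouville_onSteady` (= the critic's test, decided:
  RESTRICTED to steady fields L_Q is a theorem, so bounded-steady Liouville is NOT a sub-case of L_Q),
  `quiescentLiouville_onPeriodic`; §3 `typeIAncientLiouville_onSteady` (door stmt-4050's Type-I class is blind to
  steady fields too; stronger one-steady-slice version = CLOSED item stmt-10572 `ClockStretchingLaw.SteadySliceLiouville`).
* §4 THE WALL SITS IN THE ETERNAL DOOR: `steadyLiouville_of_eternalLiouville` — ETERNAL LIOUVILLE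
  (stmt-18161) ⟹ bounded steady CLASSICAL Liouville on `ℝ³` («a smooth steady solution of Navier–Stokes
  with bounded velocity is constant», typed over the tree's `IsSteadyClassicalNS 1 0`), through the tree
  bridge `IsSteadyClassicalNS.eq_heatExtension_sub_oseenDuhamel` (KNSS Lemma 3.1 + steady drift kill) and
  the landed class conversion `TypeILiouvilleShadowExtraction.eternal_package`; `steadyLiouville_of_liouvilleL`.
* §5 THE SIEVED CUT `liouvilleL_iff_sieved`: (L) ⟺ EL ∧ BCL|non-recurrent ∧ LSL|non-recurrent (exact,
  unconditional, from `liouvilleL_iff_three_doors` + §2 by excluded middle on recurrence); root reach is NOT restated here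
  (writer port rule: no summit-headed decls in helper files) — it is the tree's
  `TypeILiouvilleGlobalFading.closes_root_typeI` composed with `liouvilleL_iff_sieved.2` (the lens file's `closes_root_sieved`).

READING: in `(L) ⟺ EL ∧ BCL ∧ LSL` the recurrent stratum — where the problem is «open even in the steady-state
case» [cite: KochNadirashviliSereginSverak2009, §1 p. 3 and §5 p. 9 (arXiv:0709.3599)] — is carried ENTIRELY by
EL; L_Q, BCL, LSL (and 4050) hold on it outright. Census consequence: L_Q, BCL, LSL KNOWN-WEAKER than (L) in
the template's letter [separating class: steady / periodic bounded flows], flagged honestly as separation BY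
BLINDNESS (the fading hypothesis degenerates there); «steady Liouville from L_Q» can only be a genuine
(non-restriction) reduction — none known, none claimed. Converse of §4 is print-routine (KNSS 2009 §4) and NOT
certified here. Helper for stmt-NavierStokesRegularity-10661 (`--supports`); closes no item.
-/

noncomputable section
open MeasureTheory Filter Set Function Metric
open scoped Topology
open Literature.Analysis Literature.Analysis.FluidPDE Literature.Analysis.UnboundedOperators
open Summit.NavierStokesRegularity.NavierStokesRegularity
open Summit.NavierStokesRegularity.NavierStokesRegularity.Theorems
set_option linter.dupNamespace false
namespace Summit.NavierStokesRegularity.NavierStokesRegularity.Theorems.TypeILiouvilleSteadySieve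

/-! ## §1 Uniformly recurrent pasts: quiescent slices are constant (no PDE) -/

section Recurrent

variable {v : ℝ → EuclideanSpace ℝ (Fin 3) → EuclideanSpace ℝ (Fin 3)}

/-- A STEADY past (`v s = v t` for all `s, t < 0`) is uniformly recurrent. -/
theorem recurrent_of_steady (hst : ∀ s t : ℝ, s < 0 → t < 0 → v s = v t) :
    ∀ t < 0, ∀ ε : ℝ, 0 < ε → ∀ T : ℝ, T < 0 → ∃ s : ℝ, s < T ∧ ∀ x, ‖v s x - v t x‖ ≤ ε := by
  intro t ht ε hε T hT
  refine ⟨T - 1, by linarith, fun x => ?_⟩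
  rw [hst (T - 1) t (by linarith) ht, sub_self, norm_zero]
  exact hε.le

/-- A time-PERIODIC past (`v (t − P) = v t` for `t < 0`, some period `P > 0`) is uniformly recurrent. -/
theorem recurrent_of_periodic {P : ℝ} (hP : 0 < P) (hper : ∀ t < 0, v (t - P) = v t) :
    ∀ t < 0, ∀ ε : ℝ, 0 < ε → ∀ T : ℝ, T < 0 → ∃ s : ℝ, s < T ∧ ∀ x, ‖v s x - v t x‖ ≤ ε := by
  intro t ht ε hε T hT
  have hiter : ∀ n : ℕ, v (t - n * P) = v t := by
    intro n
    induction n with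
    | zero => simp
    | succ n ih =>
      have hnP : (0 : ℝ) ≤ n * P := by positivity
      have hneg : t - n * P < 0 := by linarith
      have h := hper (t - n * P) hneg
      rw [show t - (n : ℝ) * P - P = t - ((n + 1 : ℕ) : ℝ) * P by push_cast; ring] at h
      rw [h, ih]
  obtain ⟨n, hn⟩ := exists_nat_gt ((t - T) / P)
  refine ⟨t - n * P, ?_, fun x => ?_⟩
  · have h := (div_lt_iff₀ hP).1 hn
    linarith
  · rw [hiter n, sub_self, norm_zero]
    exact hε.le

/-- **Quiescent + uniformly recurrent ⟹ every slice is constant** (pure metric chaining, no PDE): the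
unit-scale oscillation of the slice `v t` is at most `3ε` for every `ε > 0` (compare with a deep slice
`v s`, `s < T(ε)`, through recurrence), and the landed chain estimate `norm_sub_le_mul_dist_add_one`
spreads it to all pairs. -/
theorem slice_const_of_quiescent_recurrent
    (hq : ∀ ε : ℝ, 0 < ε → ∃ T : ℝ, T < 0 ∧ ∀ t < T, ∀ x y : EuclideanSpace ℝ (Fin 3),
      dist x y ≤ 1 → ‖v t x - v t y‖ ≤ ε)
    (hR : ∀ t < 0, ∀ ε : ℝ, 0 < ε → ∀ T : ℝ, T < 0 → ∃ s : ℝ, s < T ∧ ∀ x, ‖v s x - v t x‖ ≤ ε) :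
    ∀ t < 0, ∀ x y : EuclideanSpace ℝ (Fin 3), v t x = v t y := by
  intro t ht x y
  have hle : ∀ ε : ℝ, 0 < ε → ‖v t x - v t y‖ ≤ 3 * ε * (dist x y + 1) := by
    intro ε hε
    obtain ⟨T, hT0, hT⟩ := hq ε hε
    obtain ⟨s, hsT, hs⟩ := hR t ht ε hε T hT0
    have hunit : ∀ a b : EuclideanSpace ℝ (Fin 3), dist a b ≤ 1 → ‖v t a - v t b‖ ≤ 3 * ε := by
      intro a b hab
      calc ‖v t a - v t b‖ = ‖(v t a - v s a) + (v s a - v s b) + (v s b - v t b)‖ := by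
              congr 1; abel
        _ ≤ ‖v t a - v s a‖ + ‖v s a - v s b‖ + ‖v s b - v t b‖ := norm_add₃_le
        _ ≤ ε + ε + ε := by
              gcongr
              · rw [norm_sub_rev]; exact hs a
              · exact hT s hsT a b hab
              · exact hs b
        _ = 3 * ε := by ring
    exact TypeILiouvilleGlobalFading.norm_sub_le_mul_dist_add_one (by positivity) hunit x y
  have h0 : ‖v t x - v t y‖ ≤ 0 := by
    refine le_of_forall_pos_le_add fun ε hε => ?_
    have hd : 0 < dist x y + 1 := by positivity
    have h := hle (ε / (3 * (dist x y + 1))) (by positivity)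
    calc ‖v t x - v t y‖ ≤ 3 * (ε / (3 * (dist x y + 1))) * (dist x y + 1) := h
      _ = ε := by field_simp
      _ = 0 + ε := (zero_add ε).symm
  exact sub_eq_zero.1 (norm_le_zero_iff.1 h0)

/-- **Backward convergence + uniform recurrence force `v ≡ c` on `t < 0`** (no PDE): the mechanism by
which BACKWARD-CONVERGENT LIOUVILLE is blind to the recurrent stratum. -/
theorem eq_const_of_backwardConvergent_recurrent {c : EuclideanSpace ℝ (Fin 3)}
    (hBC : ∀ η : ℝ, 0 < η → ∃ T : ℝ, T < 0 ∧ ∀ t < T, ∀ x, ‖v t x - c‖ ≤ η)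
    (hR : ∀ t < 0, ∀ ε : ℝ, 0 < ε → ∀ T : ℝ, T < 0 → ∃ s : ℝ, s < T ∧ ∀ x, ‖v s x - v t x‖ ≤ ε) :
    ∀ t < 0, ∀ x, v t x = c := by
  intro t ht x
  have h0 : ‖v t x - c‖ ≤ 0 := by
    refine le_of_forall_pos_le_add fun η hη => ?_
    obtain ⟨T, hT0, hT⟩ := hBC (η / 2) (by positivity)
    obtain ⟨s, hsT, hs⟩ := hR t ht (η / 2) (by positivity) T hT0
    calc ‖v t x - c‖ = ‖(v t x - v s x) + (v s x - c)‖ := by congr 1; abel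
      _ ≤ ‖v t x - v s x‖ + ‖v s x - c‖ := norm_add_le _ _
      _ ≤ η / 2 + η / 2 := add_le_add (by rw [norm_sub_rev]; exact hs x) (hT s hsT x)
      _ = 0 + η := by ring
  exact sub_eq_zero.1 (norm_le_zero_iff.1 h0)

/-! ## §2 The fading doors L_Q, BCL, LSL are blind to the recurrent stratum -/

/-- **L_Q on the recurrent stratum** (print's class; only the landed momentum anchor
`backwardConvergent_of_globallyFading` is used — KNSS 2009 §4 / Remark 6.1): quiescent + uniformly
recurrent past ⟹ constant. (The weak divergence-free hypothesis of print's class is not even needed.) -/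
theorem quiescentLiouville_onRecurrent
    (hcont : ContinuousOn (uncurry v) (Iio 0 ×ˢ univ))
    (hbdd : ∃ K : ℝ, ∀ t < 0, ∀ x, ‖v t x‖ ≤ K)
    (hmild : ∀ s t : ℝ, s < t → t < 0 → ∀ x,
      v t x = Literature.Analysis.UnboundedOperators.heatExtension (v s) (t - s) x -
        Literature.Analysis.FluidPDE.oseenDuhamel 1 s v v t x)
    (hq : ∀ ε : ℝ, 0 < ε → ∃ T : ℝ, T < 0 ∧ ∀ t < T, ∀ x y : EuclideanSpace ℝ (Fin 3),
      dist x y ≤ 1 → ‖v t x - v t y‖ ≤ ε)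
    (hR : ∀ t < 0, ∀ ε : ℝ, 0 < ε → ∀ T : ℝ, T < 0 → ∃ s : ℝ, s < T ∧ ∀ x, ‖v s x - v t x‖ ≤ ε) :
    ∃ b : EuclideanSpace ℝ (Fin 3), ∀ t < 0, ∀ x, v t x = b := by
  have hsl := slice_const_of_quiescent_recurrent hq hR
  have hGF : ∀ θ : ℝ, 0 < θ → ∃ T : ℝ, T < 0 ∧ ∀ t < T, ∀ x y : EuclideanSpace ℝ (Fin 3),
      ‖v t x - v t y‖ ≤ θ := fun θ hθ =>
    ⟨-1, by norm_num, fun t ht x y => by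
      rw [hsl t (by linarith) x y, sub_self, norm_zero]
      exact hθ.le⟩
  obtain ⟨c, hc⟩ :=
    TypeILiouvilleGlobalFading.backwardConvergent_of_globallyFading hcont hbdd hmild hGF
  exact ⟨c, eq_const_of_backwardConvergent_recurrent hc hR⟩

end Recurrent

/-- **L_Q|steady IS A THEOREM** — the critic's standing test «steady Liouville from L_Q» (CRITIC-LEDGER
rows 188/230) decided for RESTRICTION: on steady members of print's class the registered residual
`stub_quiescentLiouville` (binders verbatim + the steadiness hypothesis) holds outright; hence the bounded
steady Liouville problem is NOT a sub-case of L_Q, and any «L_Q ⟹ steady Liouville» would have to be a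
genuine reduction. [cite: KochNadirashviliSereginSverak2009, §1 p. 3 «open even in the steady-state case»
(arXiv:0709.3599)] -/
theorem quiescentLiouville_onSteady :
    ∀ v : ℝ → EuclideanSpace ℝ (Fin 3) → EuclideanSpace ℝ (Fin 3),
      ContinuousOn (uncurry v) (Iio 0 ×ˢ univ) →
      (∃ K : ℝ, ∀ t < 0, ∀ x, ‖v t x‖ ≤ K) →
      (∀ t < 0, Literature.Analysis.FluidPDE.IsWeaklyDivFree (v t)) →
      (∀ s t : ℝ, s < t → t < 0 → ∀ x,
        v t x = Literature.Analysis.UnboundedOperators.heatExtension (v s) (t - s) x -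
          Literature.Analysis.FluidPDE.oseenDuhamel 1 s v v t x) →
      (∀ s t : ℝ, s < 0 → t < 0 → v s = v t) →
      (∀ ε : ℝ, 0 < ε → ∃ T : ℝ, T < 0 ∧ ∀ t < T, ∀ x y : EuclideanSpace ℝ (Fin 3),
        dist x y ≤ 1 → ‖v t x - v t y‖ ≤ ε) →
      ∃ b : EuclideanSpace ℝ (Fin 3), ∀ t < 0, ∀ x, v t x = b := by
  intro v hc hK _hd hm hst hq
  exact quiescentLiouville_onRecurrent hc hK hm hq (recurrent_of_steady hst)

/-- **L_Q|periodic is a theorem** (time-periodic members of print's class, period `P > 0`). -/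
theorem quiescentLiouville_onPeriodic :
    ∀ v : ℝ → EuclideanSpace ℝ (Fin 3) → EuclideanSpace ℝ (Fin 3),
      ContinuousOn (uncurry v) (Iio 0 ×ˢ univ) →
      (∃ K : ℝ, ∀ t < 0, ∀ x, ‖v t x‖ ≤ K) →
      (∀ t < 0, Literature.Analysis.FluidPDE.IsWeaklyDivFree (v t)) →
      (∀ s t : ℝ, s < t → t < 0 → ∀ x,
        v t x = Literature.Analysis.UnboundedOperators.heatExtension (v s) (t - s) x -
          Literature.Analysis.FluidPDE.oseenDuhamel 1 s v v t x) →
      (∃ P : ℝ, 0 < P ∧ ∀ t < 0, v (t - P) = v t) →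
      (∀ ε : ℝ, 0 < ε → ∃ T : ℝ, T < 0 ∧ ∀ t < T, ∀ x y : EuclideanSpace ℝ (Fin 3),
        dist x y ≤ 1 → ‖v t x - v t y‖ ≤ ε) →
      ∃ b : EuclideanSpace ℝ (Fin 3), ∀ t < 0, ∀ x, v t x = b := by
  intro v hc hK _hd hm hper hq
  obtain ⟨P, hP, hper⟩ := hper
  exact quiescentLiouville_onRecurrent hc hK hm hq (recurrent_of_periodic hP hper)

/-- **BCL on the recurrent stratum is a theorem** (door BACKWARD-CONVERGENT LIOUVILLE of g21, binders
verbatim + uniform recurrence; no PDE is used). -/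
theorem bcl_onRecurrent :
    ∀ v : ℝ → EuclideanSpace ℝ (Fin 3) → EuclideanSpace ℝ (Fin 3),
      ContinuousOn (uncurry v) (Iio 0 ×ˢ univ) →
      (∃ K : ℝ, ∀ t < 0, ∀ x, ‖v t x‖ ≤ K) →
      (∀ t < 0, Literature.Analysis.FluidPDE.IsWeaklyDivFree (v t)) →
      (∀ s t : ℝ, s < t → t < 0 → ∀ x,
        v t x = Literature.Analysis.UnboundedOperators.heatExtension (v s) (t - s) x -
          Literature.Analysis.FluidPDE.oseenDuhamel 1 s v v t x) →
      (∀ t < 0, ∀ ε : ℝ, 0 < ε → ∀ T : ℝ, T < 0 → ∃ s : ℝ, s < T ∧ ∀ x, ‖v s x - v t x‖ ≤ ε) →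
      (∃ c : EuclideanSpace ℝ (Fin 3), ∀ η : ℝ, 0 < η → ∃ T : ℝ, T < 0 ∧ ∀ t < T, ∀ x,
        ‖v t x - c‖ ≤ η) →
      ∃ b : EuclideanSpace ℝ (Fin 3), ∀ t < 0, ∀ x, v t x = b := by
  intro v _hc _hK _hd _hm hR hBC
  obtain ⟨c, hc⟩ := hBC
  exact ⟨c, eq_const_of_backwardConvergent_recurrent hc hR⟩

/-- **LSL on the recurrent stratum is a theorem** (door «LOCALLY FADING, GLOBALLY STIRRED» of g21). -/
theorem lsl_onRecurrent :
    ∀ v : ℝ → EuclideanSpace ℝ (Fin 3) → EuclideanSpace ℝ (Fin 3),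
      ContinuousOn (uncurry v) (Iio 0 ×ˢ univ) →
      (∃ K : ℝ, ∀ t < 0, ∀ x, ‖v t x‖ ≤ K) →
      (∀ t < 0, Literature.Analysis.FluidPDE.IsWeaklyDivFree (v t)) →
      (∀ s t : ℝ, s < t → t < 0 → ∀ x,
        v t x = Literature.Analysis.UnboundedOperators.heatExtension (v s) (t - s) x -
          Literature.Analysis.FluidPDE.oseenDuhamel 1 s v v t x) →
      (∀ t < 0, ∀ ε : ℝ, 0 < ε → ∀ T : ℝ, T < 0 → ∃ s : ℝ, s < T ∧ ∀ x, ‖v s x - v t x‖ ≤ ε) →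
      (∀ ε : ℝ, 0 < ε → ∃ T : ℝ, T < 0 ∧ ∀ t < T, ∀ x y : EuclideanSpace ℝ (Fin 3),
        dist x y ≤ 1 → ‖v t x - v t y‖ ≤ ε) →
      (∃ θ : ℝ, 0 < θ ∧ ∀ T : ℝ, T < 0 → ∃ t : ℝ, t < T ∧ ∃ x y : EuclideanSpace ℝ (Fin 3),
        θ < ‖v t x - v t y‖) →
      ∃ b : EuclideanSpace ℝ (Fin 3), ∀ t < 0, ∀ x, v t x = b := by
  intro v hc hK _hd hm hR hq _hS
  exact quiescentLiouville_onRecurrent hc hK hm hq hR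

/-! ## §3 The Type-I door stmt-4050 is blind to steady fields -/

/-- **Type-I decay + steadiness ⟹ `u ≡ 0`** (the class of door stmt-NavierStokesRegularity-4050
`Theses.SymmetryModuliCount.TypeIAncientLiouville` carries `HasTypeITimeDecay C u`): look at the same
value at a time `s → −∞`, where `C/√(−s) → 0`. The tree books the stronger one-steady-SLICE version as
the closed item stmt-NavierStokesRegularity-10572 `Theses.ClockStretchingLaw.SteadySliceLiouville`. -/
theorem typeIAncientLiouville_onSteady :
    ∀ (C : ℝ) (u : ℝ → EuclideanSpace ℝ (Fin 3) → EuclideanSpace ℝ (Fin 3)),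
      Literature.Analysis.FluidPDE.HasTypeITimeDecay C u →
      (∀ s t : ℝ, s < 0 → t < 0 → u s = u t) → ∀ t < 0, ∀ x, u t x = 0 := by
  intro C u hI hst t ht x
  have h0 : ‖u t x‖ ≤ 0 := by
    refine le_of_forall_pos_le_add fun ε hε => ?_
    set s : ℝ := -((C / ε) ^ 2 + 1) with hs_def
    have hsq : 0 ≤ (C / ε) ^ 2 := sq_nonneg _
    have hs : s < 0 := by rw [hs_def]; linarith
    have hts : u t x = u s x := by rw [hst s t hs ht]
    rw [hts, zero_add]
    refine (hI s hs x).trans ?_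
    rcases le_or_gt C 0 with hC | hC
    · exact (div_nonpos_of_nonpos_of_nonneg hC (Real.sqrt_nonneg _)).trans hε.le
    · rw [div_le_iff₀ (Real.sqrt_pos.2 (by linarith))]
      calc C = ε * (C / ε) := by field_simp
        _ ≤ ε * Real.sqrt (-s) := by
            gcongr
            rw [hs_def, neg_neg]
            calc C / ε = Real.sqrt ((C / ε) ^ 2) := (Real.sqrt_sq (by positivity)).symm
              _ ≤ Real.sqrt ((C / ε) ^ 2 + 1) := Real.sqrt_le_sqrt (by linarith)
  exact norm_le_zero_iff.1 h0

/-! ## §4 The steady wall sits inside the ETERNAL door -/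

/-- **ETERNAL LIOUVILLE ⟹ BOUNDED STEADY LIOUVILLE (classical form).** `Theses.TypeTwoEternal.EternalLiouville`
(stmt-NavierStokesRegularity-18161) implies: a smooth steady solution `(W, P)` of Navier–Stokes on `ℝ³`
(unit viscosity, no force; tree `IsSteadyClassicalNS 1 0 W P`) with bounded velocity is constant. Bridge: a
bounded steady classical flow is Oseen-mild from its own datum (tree
`IsSteadyClassicalNS.eq_heatExtension_sub_oseenDuhamel`, KNSS 2009 Lemma 3.1 + the steady drift kill of §1
p. 3), so the constant-in-time field is an eternal bounded Oseen-mild field, which the landed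
`TypeILiouvilleShadowExtraction.eternal_package` places in EL's class. The CONCLUSION is open in print
(«it is open even in the steady-state case»). [cite: KochNadirashviliSereginSverak2009, §1 p. 3, §3 Lemma 3.1,
§5 p. 9 (arXiv:0709.3599)] -/
theorem steadyLiouville_of_eternalLiouville (hE : Theses.TypeTwoEternal.EternalLiouville) :
    ∀ (W : EuclideanSpace ℝ (Fin 3) → EuclideanSpace ℝ (Fin 3)) (P : EuclideanSpace ℝ (Fin 3) → ℝ),
      Literature.Analysis.FluidPDE.IsSteadyClassicalNS 1 0 W P →
      (∃ M : ℝ, ∀ x, ‖W x‖ ≤ M) → ∃ b : EuclideanSpace ℝ (Fin 3), ∀ x, W x = b := by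
  intro W P hNS hM
  obtain ⟨M, hM⟩ := hM
  have hW1 : ContDiff ℝ 1 W := hNS.smooth_velocity.of_le (by exact_mod_cast le_top)
  have hdiv : IsWeaklyDivFree W := VectorCalculus.IsDivFree.isWeaklyDivFree_holds hNS.divFree hW1
  have hcont : Continuous (uncurry fun _ : ℝ => W) :=
    hNS.smooth_velocity.continuous.comp continuous_snd
  have hmild : ∀ s t : ℝ, s < t → ∀ x,
      (fun _ : ℝ => W) t x =
        Literature.Analysis.UnboundedOperators.heatExtension ((fun _ : ℝ => W) s) (t - s) x -
          oseenDuhamel 1 s (fun _ : ℝ => W) (fun _ : ℝ => W) t x := by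
    intro s t hst x
    have h := hNS.eq_heatExtension_sub_oseenDuhamel hM (sub_pos.2 hst) x
    have htr := oseenDuhamel_translate 1 0 s (fun _ : ℝ => W) (fun _ : ℝ => W) (t - s) x
    rw [zero_add, sub_add_cancel] at htr
    show W x = Literature.Analysis.UnboundedOperators.heatExtension W (t - s) x -
      oseenDuhamel 1 s (fun _ : ℝ => W) (fun _ : ℝ => W) t x
    rw [← htr]
    exact h
  obtain ⟨h1, h2, h3, h4⟩ := TypeILiouvilleShadowExtraction.eternal_package (W := fun _ : ℝ => W)
    (C := M) hcont (fun _ => hdiv) (fun _ x => hM x) hmild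
  exact hE (fun _ : ℝ => W) h1 h2 h3 h4 0

/-- **(L) ⟹ BOUNDED STEADY LIOUVILLE** (through the landed `eternalLiouville_of_liouvilleL`): the KNSS crux
stmt-10661 carries the steady wall — and by §2 none of it sits in L_Q, BCL or LSL: in the exact cut
`(L) ⟺ EL ∧ BCL ∧ LSL` (`TypeILiouvilleGlobalFading.liouvilleL_iff_three_doors`) the recurrent stratum is
sieved ENTIRELY into the eternal door. -/
theorem steadyLiouville_of_liouvilleL (hL : Theses.TypeILiouville.TypeIliouvilleL) :
    ∀ (W : EuclideanSpace ℝ (Fin 3) → EuclideanSpace ℝ (Fin 3)) (P : EuclideanSpace ℝ (Fin 3) → ℝ),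
      Literature.Analysis.FluidPDE.IsSteadyClassicalNS 1 0 W P →
      (∃ M : ℝ, ∀ x, ‖W x‖ ≤ M) → ∃ b : EuclideanSpace ℝ (Fin 3), ∀ x, W x = b :=
  steadyLiouville_of_eternalLiouville (TypeILiouvilleQuiescentShadow.eternalLiouville_of_liouvilleL hL)

/-! ## §5 The sieved cut and root reach: (L) ⟺ EL ∧ BCL|generic ∧ LSL|generic (generic = NON-recurrent past) -/

/-- **THE SIEVED CUT (exact, unconditional).** Since BCL and LSL hold outright on uniformly recurrent pasts
(§2), the three-door cut of g21 sharpens for free to: (L) ⟺ ETERNAL LIOUVILLE ∧ BCL restricted to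
NON-recurrent pasts ∧ LSL restricted to NON-recurrent pasts — the special (recurrent: steady, periodic, …)
stratum is carried by EL alone, the generic (non-recurrent) stratum by the fading doors. The removed cells are
DECORATIVE BY BLINDNESS (kernel theorems `bcl_onRecurrent`, `lsl_onRecurrent`), which is exactly the
certificate's content; no new residual is claimed. -/
theorem liouvilleL_iff_sieved :
    Theses.TypeILiouville.TypeIliouvilleL ↔
      (Theses.TypeTwoEternal.EternalLiouville ∧
      (∀ v : ℝ → EuclideanSpace ℝ (Fin 3) → EuclideanSpace ℝ (Fin 3),
      ContinuousOn (uncurry v) (Iio 0 ×ˢ univ) →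
      (∃ K : ℝ, ∀ t < 0, ∀ x, ‖v t x‖ ≤ K) →
      (∀ t < 0, Literature.Analysis.FluidPDE.IsWeaklyDivFree (v t)) →
      (∀ s t : ℝ, s < t → t < 0 → ∀ x,
        v t x = Literature.Analysis.UnboundedOperators.heatExtension (v s) (t - s) x -
          Literature.Analysis.FluidPDE.oseenDuhamel 1 s v v t x) →
      (¬ ∀ t < 0, ∀ ε : ℝ, 0 < ε → ∀ T : ℝ, T < 0 → ∃ s : ℝ, s < T ∧ ∀ x, ‖v s x - v t x‖ ≤ ε) →
      (∃ c : EuclideanSpace ℝ (Fin 3), ∀ η : ℝ, 0 < η → ∃ T : ℝ, T < 0 ∧ ∀ t < T, ∀ x,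
        ‖v t x - c‖ ≤ η) →
      ∃ b : EuclideanSpace ℝ (Fin 3), ∀ t < 0, ∀ x, v t x = b) ∧
      (∀ v : ℝ → EuclideanSpace ℝ (Fin 3) → EuclideanSpace ℝ (Fin 3),
      ContinuousOn (uncurry v) (Iio 0 ×ˢ univ) →
      (∃ K : ℝ, ∀ t < 0, ∀ x, ‖v t x‖ ≤ K) →
      (∀ t < 0, Literature.Analysis.FluidPDE.IsWeaklyDivFree (v t)) →
      (∀ s t : ℝ, s < t → t < 0 → ∀ x,
        v t x = Literature.Analysis.UnboundedOperators.heatExtension (v s) (t - s) x -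
          Literature.Analysis.FluidPDE.oseenDuhamel 1 s v v t x) →
      (¬ ∀ t < 0, ∀ ε : ℝ, 0 < ε → ∀ T : ℝ, T < 0 → ∃ s : ℝ, s < T ∧ ∀ x, ‖v s x - v t x‖ ≤ ε) →
      (∀ ε : ℝ, 0 < ε → ∃ T : ℝ, T < 0 ∧ ∀ t < T, ∀ x y : EuclideanSpace ℝ (Fin 3),
        dist x y ≤ 1 → ‖v t x - v t y‖ ≤ ε) →
      (∃ θ : ℝ, 0 < θ ∧ ∀ T : ℝ, T < 0 → ∃ t : ℝ, t < T ∧ ∃ x y : EuclideanSpace ℝ (Fin 3),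
        θ < ‖v t x - v t y‖) →
      ∃ b : EuclideanSpace ℝ (Fin 3), ∀ t < 0, ∀ x, v t x = b)) := by
  rw [TypeILiouvilleGlobalFading.liouvilleL_iff_three_doors]
  refine and_congr_right fun _ => ⟨fun h => ⟨fun v hc hK hd hm _ hBC => h.1 v hc hK hd hm hBC,
    fun v hc hK hd hm _ hq hS => h.2 v hc hK hd hm hq hS⟩, fun h => ⟨fun v hc hK hd hm hBC => ?_,
    fun v hc hK hd hm hq hS => ?_⟩⟩
  · by_cases hR : ∀ t < 0, ∀ ε : ℝ, 0 < ε → ∀ T : ℝ, T < 0 → ∃ s : ℝ, s < T ∧ ∀ x, ‖v s x - v t x‖ ≤ ε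
    · exact bcl_onRecurrent v hc hK hd hm hR hBC
    · exact h.1 v hc hK hd hm hR hBC
  · by_cases hR : ∀ t < 0, ∀ ε : ℝ, 0 < ε → ∀ T : ℝ, T < 0 → ∃ s : ℝ, s < T ∧ ∀ x, ‖v s x - v t x‖ ≤ ε
    · exact lsl_onRecurrent v hc hK hd hm hR hq hS
    · exact h.2 v hc hK hd hm hR hq hS

end Summit.NavierStokesRegularity.NavierStokesRegularity.Theorems.TypeILiouvilleSteadySieve

end
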